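import Mathlib
import HarnessLib
import Literature.NumberTheory.GaloisRepresentations.DecomposedGenericOfQuadratic

/-!
# Stub `stub_enormousResidualPackage` of crux `TensorSquareParallel` (stmt-Langlands-17009), line
# `merged` — helper 1: Caraiani–Newton Lemma 6.2.2 for `GL₂(k)`, `char k = p`

Crux `stmt-Langlands-17009` = `Summit.Langlands.Langlands.Theses.NonParallelVoid.TensorSquareParallel`
(line `merged`; the stub supplies hypotheses (iii)–(iv) of Qian 2023, Thm. 1.4 for the residual
representation of `ρ : Γ_F → GL₂(ℚ̄_p)`, `F` imaginary quadratic, projectively dihedral corner).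
All PROVED (no named fact):

* `isDecomposedGeneric_of_projectiveImage_ne_bot` — **Caraiani–Newton 2023, Lemma 6.2.2** for
  `τ : Γ_F →* GL₂(k)`, `[F : ℚ] = 2`, `k` ANY field of odd characteristic `p`, `τ` with open kernel,
  under the hypothesis that `M = Proj τ(Γ_{F(ζ_p)})` is finite, non-trivial, of order prime to `p`
  (the printed hypothesis "`ρ̄|_{G_{F(ζ_p)}}` absolutely irreducible", `ρ̄` into `GL₂(𝔽_p)`, enters the
  printed proof only to produce a non-identity element of `M` of order prime to `p`, by Dickson).
  Proof = the tree's `isDecomposedGeneric_of_isAbsolutelyIrreducible_restrictField_cyclotomic`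
  (`DecomposedGenericOfQuadratic`, `𝔽_p`-coefficients, continuous `ρ̄`) verbatim, with the heart
  `exists_disc_ne_zero_and_disc_apply_ne_zero_of_ne_bot` redone over `k`
  (`disc_ne_zero_of_projective_of_charP`) and `l ≡ 1 (mod p) ⇒ l = 1 in k` by `CharP`.
* `stub_enormousResidualPackage_decomposedGeneric` — the same as a closed formula (the sub-goal
  registered on the crux item for this file).

## References

* [CaraianiNewton2023] A. Caraiani, J. Newton, *On the modularity of elliptic curves over imaginary
  quadratic fields*, arXiv:2301.10509v3, §6.2, Lemma 6.2.2 and its proof (pp. 90–91).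
* [ACCGHLNSTT2023] P. B. Allen et al., *Potential automorphy over CM fields*, Ann. of Math. 197
  (2023), Def. 4.3.1 (decomposed generic).
-/

set_option linter.dupNamespace false

noncomputable section

namespace Summit.Langlands.Langlands.Theorems.TensorSquareParallel

open scoped MatrixGroups NumberField Polynomial Pointwise Topology
open NumberField IsDedekindDomain Field Filter Rat.HeightOneSpectrum
open Literature.NumberTheory.GaloisRepresentations
open Literature.NumberTheory.GaloisRepresentations.CaraianiNewton

universe u v w

/-! ## §1. The group-theoretic heart over a field of characteristic `p` -/
section Heart

variable {p : ℕ} [Fact p.Prime] {k : Type w} [Field k] [CharP k p]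

/-- For `p` odd and `char k = p`, an element of `GL₂(k)` whose image in `PGL₂(k)` is a non-identity
element of order prime to `p` has distinct eigenvalues (`tr² - 4 det ≠ 0`): the tree's
`CaraianiNewton.disc_ne_zero_of_projective` with `𝔽_p` replaced by `k`
(`disc_ne_zero_of_pow_eq_smul_one`). [cite: CaraianiNewton2023, Lemma 6.2.2 (proof)] -/
theorem disc_ne_zero_of_projective_of_charP (hp2 : p ≠ 2) {g : GL (Fin 2) k}
    (hg1 : Matrix.ProjGenLinGroup.mk g ≠ 1) (hgp : ¬ p ∣ orderOf (Matrix.ProjGenLinGroup.mk g)) :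
    (g : Matrix (Fin 2) (Fin 2) k).trace ^ 2 - 4 * (g : Matrix (Fin 2) (Fin 2) k).det ≠ 0 := by
  have hp : p.Prime := Fact.out
  have htwo : (2 : k) ≠ 0 := fun h ↦ by
    have h' : ((2 : ℕ) : k) = 0 := by exact_mod_cast h
    exact hp2 ((Nat.prime_dvd_prime_iff_eq hp Nat.prime_two).1 ((CharP.cast_eq_zero_iff k p _).1 h'))
  -- `g` is non-scalar
  have hns : ∀ c : k, (g : Matrix (Fin 2) (Fin 2) k) ≠ c • 1 := by
    intro c hc
    apply hg1
    have hc0 : c ≠ 0 := fun h0 ↦ GL2.det_ne_zero g (by rw [hc, h0, zero_smul, Matrix.det_zero])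
    rw [Matrix.ProjGenLinGroup.mk_eq_one, Matrix.GeneralLinearGroup.center_eq_range_scalar]
    refine ⟨Units.mk0 c hc0, Units.ext ?_⟩
    rw [Matrix.GeneralLinearGroup.coe_scalar, Matrix.scalar_apply, hc, Matrix.smul_one_eq_diagonal]
    rfl
  -- `g^m` is a scalar for `m` the order of the image of `g` in `PGL₂`
  set m : ℕ := orderOf (Matrix.ProjGenLinGroup.mk g) with hm
  have hgm : g ^ m ∈ Subgroup.center (GL (Fin 2) k) := by
    rw [← Matrix.ProjGenLinGroup.mk_eq_one, map_pow, hm, pow_orderOf_eq_one]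
  rw [Matrix.GeneralLinearGroup.center_eq_range_scalar] at hgm
  obtain ⟨u, hu⟩ := hgm
  have hgm' : (g : Matrix (Fin 2) (Fin 2) k) ^ m = (u : k) • 1 := by
    rw [← Units.val_pow_eq_pow_val, ← hu, Matrix.GeneralLinearGroup.coe_scalar, Matrix.scalar_apply,
      Matrix.smul_one_eq_diagonal]
  exact disc_ne_zero_of_pow_eq_smul_one htwo hns (GL2.det_ne_zero g)
    (by rw [Ne, CharP.cast_eq_zero_iff k p]; exact hgp) hgm'

variable {Γ : Type u} [Group Γ]

/-- **The group-theoretic heart of Caraiani–Newton, Lemma 6.2.2, for `GL₂(k)`, `char k = p` odd**: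
`ρ̄ : Γ →* GL₂(k)`, `θ : Γ →* Γ`, `Γ₁ ≤ Γ` with `θ(Γ₁) = Γ₁`, `M = Proj ρ̄(Γ₁)` finite, non-trivial, of
order prime to `p` ⟹ some `τ ∈ Γ₁` has `ρ̄(τ)` and `ρ̄(θ τ)` regular semisimple (`tr² - 4 det ≠ 0`).
The tree's `exists_disc_ne_zero_and_disc_apply_ne_zero` (Goursat step in `M × M`), the non-identity
element of order prime to `p` being any `T ≠ 1` of `M`. [cite: CaraianiNewton2023, Lemma 6.2.2 (proof, pp. 90–91)] -/
theorem exists_disc_ne_zero_and_disc_apply_ne_zero_of_ne_bot (hp2 : p ≠ 2)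
    (ρ : Γ →* GL (Fin 2) k) (θ : Γ →* Γ) (Γ₁ : Subgroup Γ) (hθ : Γ₁.map θ = Γ₁)
    [Finite (projectiveImage (ρ.comp Γ₁.subtype))]
    (hne : projectiveImage (ρ.comp Γ₁.subtype) ≠ ⊥)
    (hcop : ¬ p ∣ Nat.card (projectiveImage (ρ.comp Γ₁.subtype))) :
    ∃ τ ∈ Γ₁,
      ((ρ τ : GL (Fin 2) k) : Matrix (Fin 2) (Fin 2) k).trace ^ 2 -
          4 * ((ρ τ : GL (Fin 2) k) : Matrix (Fin 2) (Fin 2) k).det ≠ 0 ∧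
      ((ρ (θ τ) : GL (Fin 2) k) : Matrix (Fin 2) (Fin 2) k).trace ^ 2 -
          4 * ((ρ (θ τ) : GL (Fin 2) k) : Matrix (Fin 2) (Fin 2) k).det ≠ 0 := by
  classical
  -- `θ` maps `Γ₁` onto `Γ₁`
  have hθmem : ∀ σ ∈ Γ₁, θ σ ∈ Γ₁ := fun σ hσ ↦ hθ ▸ Subgroup.mem_map_of_mem θ hσ
  have hθsurj : ∀ σ₁ ∈ Γ₁, ∃ σ ∈ Γ₁, θ σ = σ₁ := fun σ₁ hσ₁ ↦ by
    rw [← hθ] at hσ₁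
    exact Subgroup.mem_map.1 hσ₁
  -- the projective representation `P = Proj ρ̄` and the finite group `M = P(Γ₁) ⊆ PGL₂(k)`
  set P : Γ →* PGL(Fin 2, k) := Matrix.ProjGenLinGroup.mk.comp ρ with hP
  set M : Subgroup (PGL(Fin 2, k)) := projectiveImage (ρ.comp Γ₁.subtype) with hM
  have hPmem : ∀ σ ∈ Γ₁, P σ ∈ M := fun σ hσ ↦ ⟨⟨σ, hσ⟩, rfl⟩
  -- `H = {(P σ, P (θ σ)) : σ ∈ Γ₁} ≤ M × M`, with both projections onto
  let φ : Γ₁ →* M × M :=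
    { toFun := fun σ ↦ (⟨P σ, hPmem σ σ.2⟩, ⟨P (θ σ), hPmem _ (hθmem σ σ.2)⟩)
      map_one' := by ext <;> simp
      map_mul' := fun σ τ ↦ by ext <;> simp }
  have hφ1 : ∀ σ : Γ₁, ((φ σ).1 : PGL(Fin 2, k)) = P σ := fun _ ↦ rfl
  have hφ2 : ∀ σ : Γ₁, ((φ σ).2 : PGL(Fin 2, k)) = P (θ σ) := fun _ ↦ rfl
  set H : Subgroup (M × M) := φ.range with hH
  have h₁ : ∀ x : M, ∃ h ∈ H, h.1 = x := by
    rintro ⟨_, ⟨σ, rfl⟩⟩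
    exact ⟨φ σ, ⟨σ, rfl⟩, rfl⟩
  have h₂ : ∀ y : M, ∃ h ∈ H, h.2 = y := by
    rintro ⟨_, ⟨⟨σ₁, hσ₁⟩, rfl⟩⟩
    obtain ⟨σ, hσ, hθσ⟩ := hθsurj σ₁ hσ₁
    refine ⟨φ ⟨σ, hσ⟩, ⟨⟨σ, hσ⟩, rfl⟩, Subtype.ext ?_⟩
    simp only [hφ2, MonoidHom.comp_apply, Subgroup.subtype_apply, hθσ]
    rfl
  -- `M` has a non-identity element, of order prime to `p`
  obtain ⟨T, hT1'⟩ := (Subgroup.ne_bot_iff_exists_ne_one).1 hne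
  have hTp' : ¬ p ∣ orderOf T := fun h ↦ hcop (h.trans (orderOf_dvd_natCard T))
  -- the element `τ` (Goursat step) and regular semisimplicity of `ρ̄(τ)`, `ρ̄(θ τ)`
  obtain ⟨_, ⟨τ, rfl⟩, hx1, hx2, hxp1, hxp2⟩ :=
    exists_mem_fst_snd_ne_one_not_dvd_orderOf H h₁ h₂ hT1' hTp'
  refine ⟨τ, τ.2, ?_, ?_⟩
  · refine disc_ne_zero_of_projective_of_charP hp2 (g := ρ τ) (fun h ↦ hx1 (Subtype.ext ?_)) ?_
    · rw [hφ1]; exact h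
    · rwa [← orderOf_injective M.subtype Subtype.coe_injective (φ τ).1] at hxp1
  · refine disc_ne_zero_of_projective_of_charP hp2 (g := ρ (θ τ)) (fun h ↦ hx2 (Subtype.ext ?_)) ?_
    · rw [hφ2]; exact h
    · rwa [← orderOf_injective M.subtype Subtype.coe_injective (φ τ).2] at hxp2

end Heart

/-! ## §2. Caraiani–Newton, Lemma 6.2.2 over a quadratic field, `GL₂(k)`-valued, `char k = p` -/
section Main

variable {p : ℕ} [Fact p.Prime] {k : Type w} [Field k] [CharP k p]

/-- **Caraiani–Newton (2023), Lemma 6.2.2, for `τ : Γ_F →* GL₂(k)` with `char k = p`.**  `F` a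
number field with `[F : ℚ] = 2`, `p` odd, `τ` with open kernel, `Proj τ(Γ_{F(ζ_p)}) ⊆ PGL₂(k)`
finite, non-trivial, of order prime to `p` ⟹ `τ` is decomposed generic ([ACC⁺23, Def. 4.3.1]: some
prime `l ≠ p` splits completely in `F` and at every `w ∣ l`, `τ` is unramified with Frobenius
eigenvalues `α₁ ≠ α₂`, `α_i ≠ l α_j`).  Proof: the tree's
`isDecomposedGeneric_of_isAbsolutelyIrreducible_restrictField_cyclotomic` verbatim (`θ = θ_c`, the
heart `exists_disc_ne_zero_and_disc_apply_ne_zero_of_ne_bot`, a faithful Artin representation of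
`Γ_ℚ/N`, `N ≤ res(ker τ ∩ Γ_{F(ζ_p)})` open normal, Chebotarev `chebotarev_artinRep_holds` at `res τ₀`,
`l ≡ 1 (mod p)`, `l` split in `F`). [cite: CaraianiNewton2023, Lemma 6.2.2 (p. 90; proof pp. 90–91)] -/
theorem isDecomposedGeneric_of_projectiveImage_ne_bot
    (F : Type) [Field F] [NumberField F] (hF2 : Module.finrank ℚ F = 2) (hp2 : p ≠ 2)
    (τ : absoluteGaloisGroup F →* GL (Fin 2) k)
    (hker : IsOpen ((τ.ker : Subgroup (absoluteGaloisGroup F)) : Set (absoluteGaloisGroup F)))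
    [Finite (projectiveImage (τ.comp (absGaloisGroupAdjoinRootsOfUnity F p).subtype))]
    (hne : projectiveImage (τ.comp (absGaloisGroupAdjoinRootsOfUnity F p).subtype) ≠ ⊥)
    (hcop : ¬ p ∣ Nat.card (projectiveImage (τ.comp (absGaloisGroupAdjoinRootsOfUnity F p).subtype))) :
    IsDecomposedGeneric τ := by
  classical
  have hp : p.Prime := Fact.out
  haveI : Algebra.IsQuadraticExtension ℚ F := ⟨hF2⟩
  haveI : IsGalois ℚ F := inferInstance
  haveI : NeZero ((p : ℕ) : F) := NeZero.charZero
  /- Step 1: `Γ₁ = Γ_{F(ζ_p)}`. -/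
  set Γ₁ : Subgroup (absoluteGaloisGroup F) := absGaloisGroupAdjoinRootsOfUnity F p with hΓ₁
  /- Step 2: `res : Γ_F → Γ_ℚ`, its image `H` (open, normal, index two), `c ∉ H`, `θ = θ_c`. -/
  set res := absGaloisRestrict ℚ F with hres
  obtain ⟨hHopen, hHi⟩ :=
    Literature.NumberTheory.Automorphic.isOpen_range_absGaloisRestrict_and_index_eq_two ℚ F hF2
  have hHn : ((absGaloisRestrict ℚ F).range : Subgroup (absoluteGaloisGroup ℚ)).Normal :=
    normal_range_absGaloisRestrict ℚ F
  set H : Subgroup (absoluteGaloisGroup ℚ) := (absGaloisRestrict ℚ F).range with hH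
  obtain ⟨c, hc⟩ : ∃ c : absoluteGaloisGroup ℚ, c ∉ H := by
    by_contra! hall
    have htop : H = ⊤ := eq_top_iff.2 fun x _ ↦ hall x
    rw [htop, Subgroup.index_top] at hHi
    exact absurd hHi (by decide)
  set θ := absGaloisOuterConj ℚ F c with hθ
  have hθΓ₁ : Γ₁.map θ.toMonoidHom = Γ₁ :=
    map_absGaloisOuterConj_absGaloisGroupAdjoinRootsOfUnity ℚ F p c
  have hresθ : ∀ σ, res (θ σ) = c * res σ * c⁻¹ := absGaloisRestrict_absGaloisOuterConj ℚ F c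
  /- Step 3: the group-theoretic heart: `τ₀ ∈ Γ₁` with `τ(τ₀)`, `τ(θ τ₀)` regular semisimple. -/
  obtain ⟨τ₀, hτ₁, hd1, hd2⟩ :=
    exists_disc_ne_zero_and_disc_apply_ne_zero_of_ne_bot hp2 τ θ.toMonoidHom Γ₁ hθΓ₁ hne hcop
  /- Step 4: an open normal subgroup `N ≤ res(ker τ ∩ Γ₁)` of `Γ_ℚ` and a faithful Artin
  representation `S` of `Γ_ℚ / N`. -/
  have hΓ₁open : IsOpen (Γ₁ : Set (absoluteGaloisGroup F)) :=
    isOpen_absGaloisGroupAdjoinRootsOfUnity F p hp.pos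
  set U : Set (absoluteGaloisGroup ℚ) :=
    res '' (((τ.ker : Subgroup (absoluteGaloisGroup F)) : Set (absoluteGaloisGroup F)) ∩
      (Γ₁ : Set (absoluteGaloisGroup F))) with hU
  have hUopen : IsOpen U :=
    isOpenMap_absGaloisRestrict_of_isOpen_range ℚ F hHopen _ (hker.inter hΓ₁open)
  have h1U : (1 : absoluteGaloisGroup ℚ) ∈ U := ⟨1, ⟨τ.ker.one_mem, Γ₁.one_mem⟩, map_one _⟩
  obtain ⟨N, hNU⟩ := ProfiniteGrp.exist_openNormalSubgroup_sub_open_nhds_of_one hUopen h1U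
  have hN : ∀ n ∈ N.toSubgroup, ∃ n' : absoluteGaloisGroup F, τ n' = 1 ∧ n' ∈ Γ₁ ∧ res n' = n := by
    intro n hn
    obtain ⟨n', ⟨h1, h2⟩, h3⟩ := hNU hn
    exact ⟨n', (MonoidHom.mem_ker).1 h1, h2, h3⟩
  have hNH : N.toSubgroup ≤ H := fun n hn ↦ by
    obtain ⟨n', -, -, rfl⟩ := hN n hn
    exact ⟨n', rfl⟩
  obtain ⟨m, S, hSker⟩ := exists_framedArtinRep_ker_eq N
  have hSN : ∀ g : absoluteGaloisGroup ℚ, S g = 1 ↔ g ∈ N.toSubgroup := fun g ↦ by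
    rw [← hSker, MonoidHom.mem_ker]
    rfl
  /- Step 5: Chebotarev over `ℚ` at `g = res τ₀`, away from the finitely many places of `ℚ` that
  ramify in `F` or lie over `p`. -/
  have hCheb := Literature.NumberTheory.Automorphic.chebotarev_artinRep_holds ℚ m S (res τ₀)
  have hbad : ({v : HeightOneSpectrum (𝓞 ℚ) | ¬ Algebra.IsUnramifiedIn (𝓞 F) v.asIdeal} ∪
      {v : HeightOneSpectrum (𝓞 ℚ) | ((p : ℕ) : 𝓞 ℚ) ∈ v.asIdeal}).Finite :=
    (finite_setOf_not_isUnramifiedIn ℚ F).union (Rat.finite_setOf_natCast_mem hp)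
  obtain ⟨v, ⟨hSunr, 𝔓₀, h𝔓₀, Φ, hΦ, hSΦ⟩, hvbad⟩ := (hCheb.sdiff hbad).nonempty
  simp only [Set.mem_union, Set.mem_setOf_eq, not_or, not_not] at hvbad
  obtain ⟨hunr, hpv⟩ := hvbad
  -- the rational prime `l` below `v`
  set l : ℕ := natGenerator v with hl
  have hlprime : l.Prime := prime_natGenerator v
  have hlv : (l : 𝓞 ℚ) ∈ v.asIdeal := (Rat.natCast_mem_asIdeal_iff v).2 dvd_rfl
  have hlp : l ≠ p := fun h ↦ hpv (h ▸ hlv)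
  have hql : v.residueCard = l := Rat.residueCard_eq_natGenerator v
  -- `Φ ≡ res τ₀ (mod N)`, so `Φ ∈ H` and `Φ ∈ Γ_{ℚ(ζ_p)}`
  have hΦN : (res τ₀)⁻¹ * Φ ∈ N.toSubgroup := by
    rw [← hSN, map_mul, map_inv, hSΦ, inv_mul_cancel]
  have hΦeq : Φ = res τ₀ * ((res τ₀)⁻¹ * Φ) := by group
  have hΦH : Φ ∈ H := by
    rw [hΦeq]
    exact H.mul_mem ⟨τ₀, rfl⟩ (hNH hΦN)
  have hΦ1 : Φ ∈ absGaloisGroupAdjoinRootsOfUnity ℚ p := by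
    have h1 : res τ₀ ∈ absGaloisGroupAdjoinRootsOfUnity ℚ p :=
      (mem_absGaloisGroupAdjoinRootsOfUnity_iff_absGaloisRestrict ℚ F p τ₀).1 hτ₁
    obtain ⟨n', -, hn'1, hn'⟩ := hN _ hΦN
    have h2 : (res τ₀)⁻¹ * Φ ∈ absGaloisGroupAdjoinRootsOfUnity ℚ p := by
      rw [← hn']
      exact (mem_absGaloisGroupAdjoinRootsOfUnity_iff_absGaloisRestrict ℚ F p n').1 hn'1
    rw [hΦeq]
    exact Subgroup.mul_mem _ h1 h2
  -- `l ≡ 1 (mod p)`, so `l = 1` in `k̄`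
  have hl1 : l ≡ 1 [MOD p] := by
    have := residueCard_modEq_one_of_isArithFrobAt_of_mem hp hpv h𝔓₀ hΦ hΦ1
    rwa [hql] at this
  have hlcast : ((l : ℕ) : AlgebraicClosure k) = 1 := by
    have h1 : ((l : ℕ) : k) = 1 := by
      rw [CharP.natCast_eq_natCast' k p hl1, Nat.cast_one]
    rw [← map_natCast (algebraMap k (AlgebraicClosure k)) l, h1, map_one]
  -- residue degree one above `v` (the places of `F` above `l` split)
  have hfin2 : (Module.finrank ℚ F).Prime := by rw [hF2]; exact Nat.prime_two
  obtain ⟨-, -, -, -, hf1, -, -⟩ := exists_places_split_of_mem_range (F := ℚ) (M := F) hfin2 hHn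
    (hHi.trans hF2.symm) hc hunr h𝔓₀ hΦ hΦH
  have hwv : ∀ w : HeightOneSpectrum (𝓞 F), ((l : ℕ) : 𝓞 F) ∈ w.asIdeal →
      w.asIdeal.under (𝓞 ℚ) = v.asIdeal := fun w hw ↦
    haveI := w.isPrime
    Rat.under_eq_asIdeal_of_natCast_mem hlprime hlv hw
  have hf : ∀ w : HeightOneSpectrum (𝓞 F), ((l : ℕ) : 𝓞 F) ∈ w.asIdeal →
      w.asIdeal.inertiaDeg (𝓞 ℚ) = 1 := fun w hw ↦
    hf1 w (HeightOneSpectrum.ext (by rw [HeightOneSpectrum.under_asIdeal]; exact hwv w hw))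
  have hqw : ∀ w : HeightOneSpectrum (𝓞 F), ((l : ℕ) : 𝓞 F) ∈ w.asIdeal → w.residueCard = l := by
    intro w hw
    rw [residueCard_eq_residueCard_pow_inertiaDeg (hwv w hw), hf w hw, pow_one, hql]
  /- Step 6: `l` is decomposed generic for `τ`. -/
  refine ⟨l, hlprime, ?_, ?_, fun w hw ↦ ⟨fun 𝔔 h𝔔 g hg ↦ ?_, fun 𝔔 h𝔔 φ hφ ↦ ?_⟩⟩
  · -- `l ≠ char k`
    rw [ringChar.eq k p]
    exact hlp
  · -- `l` splits completely in `F`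
    exact ⟨Rat.isUnramifiedIn_int_of_isUnramifiedIn hlprime hlv hunr, fun w hw ↦ hqw w hw⟩
  · -- `τ` is unramified at `w ∣ l`: inertia maps into inertia over `ℚ`, killed by `S`, so lies
    -- in `N ≤ res(ker τ)`
    have h1 : res g ∈ (𝔔.comap (absIntegersMap ℚ F)).inertia (absoluteGaloisGroup ℚ) :=
      absGaloisRestrict_mem_inertia_comap ℚ F hg
    have h2 : 𝔔.comap (absIntegersMap ℚ F) ∈ v.primesAbove :=
      comap_absIntegersMap_mem_primesAbove (hwv w hw) h𝔔
    have h3 : S (res g) = 1 := hSunr _ h2 _ h1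
    obtain ⟨n', hn'1, -, hn'⟩ := hN _ ((hSN _).1 h3)
    rw [← absGaloisRestrict_injective ℚ F hn']
    exact hn'1
  · -- Frobenius elements at `w ∣ l` are `τ`-conjugate to `τ(τ₀)` or `τ(θ τ₀)`
    have hresφ : IsArithFrobAt (𝓞 ℚ) (res φ) (𝔔.comap (absIntegersMap ℚ F)) :=
      isArithFrobAt_absGaloisRestrict_of_inertiaDeg_eq_one (hwv w hw) h𝔔 hφ (hf w hw)
    set 𝔓₁ := 𝔔.comap (absIntegersMap ℚ F) with h𝔓₁def
    have h𝔓₁ : 𝔓₁ ∈ v.primesAbove := comap_absIntegersMap_mem_primesAbove (hwv w hw) h𝔔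
    obtain ⟨γ, hγ⟩ := HeightOneSpectrum.exists_smul_eq_of_mem_primesAbove_holds h𝔓₀ h𝔓₁
    have hΦ' : IsArithFrobAt (𝓞 ℚ) (γ * Φ * γ⁻¹) 𝔓₁ := hγ ▸ hΦ.conj γ
    have hin : res φ * (γ * Φ * γ⁻¹)⁻¹ ∈ 𝔓₁.inertia (absoluteGaloisGroup ℚ) :=
      hresφ.mul_inv_mem_inertia hΦ'
    have hS1 : S (res φ * (γ * Φ * γ⁻¹)⁻¹) = 1 := hSunr _ h𝔓₁ _ hin
    have hmodN : res φ * (γ * res τ₀ * γ⁻¹)⁻¹ ∈ N.toSubgroup := by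
      rw [← hSN]
      have e : S (γ * Φ * γ⁻¹) = S (γ * res τ₀ * γ⁻¹) := by simp only [map_mul, map_inv, hSΦ]
      rw [map_mul, map_inv, ← e, ← map_inv, ← map_mul]
      exact hS1
    obtain ⟨n', hn'1, -, hn'⟩ := hN _ hmodN
    -- coset decomposition `γ = h cⁱ`, `h = res h'`, `i < 2`
    obtain ⟨i, hi, h, hhH, hγeq⟩ := exists_mem_mul_pow_eq_of_prime_index Nat.prime_two hHi hc γ
    obtain ⟨h', rfl⟩ := hhH
    change γ = res h' * c ^ i at hγeq
    have key : ∃ (g : GL (Fin 2) k) (x : absoluteGaloisGroup F),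
        (g = τ τ₀ ∨ g = τ (θ τ₀)) ∧ τ φ = τ x * g * (τ x)⁻¹ := by
      have hφn : res φ = res n' * (γ * res τ₀ * γ⁻¹) := by
        rw [hn', inv_mul_cancel_right]
      interval_cases i
      · refine ⟨τ τ₀, h', Or.inl rfl, ?_⟩
        have e : res φ = res (n' * (h' * τ₀ * h'⁻¹)) := by
          rw [hφn, hγeq, pow_zero, mul_one, map_mul, map_mul, map_mul, map_inv]
        rw [absGaloisRestrict_injective ℚ F e, map_mul, hn'1, one_mul, map_mul, map_mul, map_inv]
      · refine ⟨τ (θ τ₀), h', Or.inr rfl, ?_⟩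
        have e : res φ = res (n' * (h' * θ τ₀ * h'⁻¹)) := by
          rw [hφn, hγeq, pow_one, map_mul, map_mul, map_mul, map_inv, hresθ]
          group
        rw [absGaloisRestrict_injective ℚ F e, map_mul, hn'1, one_mul, map_mul, map_mul, map_inv]
    obtain ⟨g, x, hg, hφx⟩ := key
    have hdisc : ((g : GL (Fin 2) k) : Matrix (Fin 2) (Fin 2) k).trace ^ 2 -
        4 * ((g : GL (Fin 2) k) : Matrix (Fin 2) (Fin 2) k).det ≠ 0 := by
      rcases hg with rfl | rfl
      · exact hd1
      · exact hd2
    rw [hφx, eigenvalueMultiset_conj, hqw w hw]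
    exact ⟨nodup_eigenvalueMultiset_of_disc_ne_zero g hdisc, ne_mul_of_cast_eq_one hlcast _⟩

/-- **Registered sub-goal `stub_enormousResidualPackage_decomposedGeneric` of stub
`stub_enormousResidualPackage`** (crux stmt-Langlands-17009, line `merged`): the statement of
`isDecomposedGeneric_of_projectiveImage_ne_bot` as a closed formula (Caraiani–Newton 2023,
Lemma 6.2.2 for `GL₂(k)`, `char k = p` odd, open kernel, non-trivial prime-to-`p` projective image
on `Γ_{F(ζ_p)}`). [cite: CaraianiNewton2023, Lemma 6.2.2 (p. 90; proof pp. 90–91)] -/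
theorem stub_enormousResidualPackage_decomposedGeneric : ∀ (F : Type) [Field F] [NumberField F], Module.finrank ℚ F = 2 → ∀ (p : ℕ) [Fact p.Prime], p ≠ 2 → ∀ (k : Type) [Field k] [CharP k p] (τ : absoluteGaloisGroup F →* GL (Fin 2) k), IsOpen ((τ.ker : Subgroup (absoluteGaloisGroup F)) : Set (absoluteGaloisGroup F)) → Finite (projectiveImage (τ.comp (absGaloisGroupAdjoinRootsOfUnity F p).subtype)) → projectiveImage (τ.comp (absGaloisGroupAdjoinRootsOfUnity F p).subtype) ≠ ⊥ → ¬ p ∣ Nat.card (projectiveImage (τ.comp (absGaloisGroupAdjoinRootsOfUnity F p).subtype)) → IsDecomposedGeneric τ := by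
  intro F _ _ hF2 p _ hp2 k _ _ τ hker hfin hne hcop
  exact isDecomposedGeneric_of_projectiveImage_ne_bot F hF2 hp2 τ hker hne hcop

end Main


end Summit.Langlands.Langlands.Theorems.TensorSquareParallel

end
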